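import Summits.QuantumFields.YangMills.Theorems.ParabolicTrajectoryLatticeGapOnTrajectoryStubTransferSym
import Summits.QuantumFields.YangMills.Theorems.ParabolicTrajectoryLatticeGapOnTrajectoryStubNegReflectRP
import Summits.QuantumFields.YangMills.Theorems.ParabolicTrajectoryLatticeGapOnTrajectoryTransferFromOSGapSlack
import Summits.QuantumFields.YangMills.Theorems.ParabolicTrajectoryLatticeGapOnTrajectoryDefs
import HarnessLib

/-!
# Crux `LatticeGapOnTrajectory` (stmt-QuantumFields-10523): NAMES for the symmetric-transfer currency
# (definitions; lead c2, line `orbit-kantorovich-finite-size`, reshape 4b)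

The registered stubs of the skeleton are stated RAW (so that landed stub files match them literally).
This file gives the three recurring raw blocks NAMES, for the planner's restatement and for other IR
lines, and records the landed bridge between them:

* `UniformSlabClustering r sch Δ` — exponential clustering at physical rate `Δ`, in cluster-expansion
  (sup-norm) format, of the reflected DIAGONAL autocorrelations `osCorr μ_k Θ₀ τ_N X X` of bounded
  measurable SLAB observables on the scheme's own torus, constant `K (a_k⁻¹ (w+1)(L_k+1))^p B²`,
  eventually in `k` uniformly in `(w, N, X)` — the currency IR engines output (= the conclusion of the
  registered `stub_slabClustering`);
* `SpeciesScheme.HasVolumeGrowth sch` — the physical volume outgrows the log of the cutoff,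
  `a_k L_k / log(a_k⁻¹) → ∞` (the clause the filed crux lacks: residual stub `stub_volume`);
* `TransferHalfSym r sch Δ` — the transfer clause restricted to reflection-symmetric, polynomially
  bounded witness renormalisations (the filed clause minus residual stub `stub_symmetrise`);
* `transferHalfSym_of_uniformSlabClustering` — `M`-adic shape + `β_k → ∞` + `HasVolumeGrowth` +
  `UniformSlabClustering r sch Δ` ⇒ `TransferHalfSym r sch Δ`, SAME rate: the landed `stub_transferSym`
  fed with the landed site reflection positivity `stub_negReflectRP` — no hypothesis left but the
  lattice ones.

References: Osterwalder–Seiler 1978 §2; Glimm–Jaffe 1987 §6.1, §19.7; Fröhlich–Israel–Lieb–Simon 1978 §2.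
-/

open scoped ComplexConjugate
open Filter MeasureTheory
open Literature.MathematicalPhysics.QuantumLattice Literature.MathematicalPhysics.QuantumFieldTheory

noncomputable section

namespace Summit.QuantumFields.YangMills.Cruxes.LatticeGapOnTrajectory.OrbitKantorovichFiniteSize

namespace Transfer

variable {G : Type} [Group G] [TopologicalSpace G] [IsTopologicalGroup G] [CompactSpace G]
  [MeasurableSpace G] [BorelSpace G]

/-- **Uniform slab clustering at physical rate `Δ` in cluster-expansion format** on the scheme's own
tori: there are `p, K ≥ 0` such that eventually in `k`, for every measurable `X` on the torus of side
`2L_k+1` with sup bound `B` depending only on the links based at lattice times `1 … w`, and every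
separation `N` with `N + 2w ≤ L_k`,
`‖osCorr μ_k Θ₀ τ_N X X‖ ≤ K (a_k⁻¹ (w+1)(L_k+1))^p B² e^{−Δ a_k N}`
(`μ_k = wilsonMeasure r.ρ β_k`, `Θ₀ = GaugeConfig.negReflect`, `τ_N = torusTimeShift _ N`).
[cite: GlimmJaffe1987, §19.7] -/
def UniformSlabClustering (r : LatticeRep G) (sch : SpeciesScheme (YMSpecies G)) (Δ : ℝ) : Prop :=
  ∃ (p : ℕ) (K : ℝ), 0 ≤ K ∧ ∀ᶠ k in atTop,
    ∀ (w N : ℕ) (X : GaugeConfig 4 (sch.side k) G → ℂ) (B : ℝ), Measurable X → (∀ U, ‖X U‖ ≤ B) →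
      DependsOn X {e : Edge 4 (sch.side k) | 1 ≤ (e.1 0).val ∧ (e.1 0).val ≤ w} →
      N + 2 * w ≤ sch.L k →
        ‖osCorr (wilsonMeasure r.ρ (sch.β k)) GaugeConfig.negReflect (torusTimeShift (sch.side k) N) X X‖ ≤
          K * ((sch.a k)⁻¹ * ((w : ℝ) + 1) * ((sch.L k : ℝ) + 1)) ^ p * B ^ 2 *
            Real.exp (-Δ * sch.a k * N)

/-- **Physical volume growth**: `a_k L_k / log(a_k⁻¹) → ∞` — the physical time extent of the
scheme's torus outgrows the logarithm of the cutoff, so that thermal / finite-size terms weighted by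
sup norms polynomial in `a_k⁻¹` are negligible. [cite: GlimmJaffe1987, §19.7] -/
def _root_.Literature.MathematicalPhysics.QuantumFieldTheory.SpeciesScheme.HasVolumeGrowth {ι : Type}
    (sch : SpeciesScheme ι) : Prop :=
  Tendsto (fun k => sch.a k * sch.L k / Real.log (sch.a k)⁻¹) atTop atTop

/-- **The transfer clause for reflection-symmetric, polynomially bounded witnesses** at rate `Δ`: every
OS datum that is a continuum limit along a scheme `sch' ~ sch` (same `a, β, L`) with
`sch'.IsReflectionSymmetric` and `HasPolynomialRenormalisations sch'` has `T.HasMassGap Δ`.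
[cite: OsterwalderSeiler1978, §2] -/
def TransferHalfSym (r : LatticeRep G) (sch : SpeciesScheme (YMSpecies G)) (Δ : ℝ) : Prop :=
  ∀ sch' : SpeciesScheme (YMSpecies G), sch'.a = sch.a → sch'.β = sch.β → sch'.L = sch.L →
    sch'.IsReflectionSymmetric → HasPolynomialRenormalisations sch' →
      ∀ T : OSData (YMSpecies G) 4, IsYangMillsFor r sch' T → T.HasMassGap Δ

/-- The symmetric transfer clause implies nothing stronger than itself but IS implied by the filed
clause `TransferHalf` (all `sch'`): the restatement is a weakening. [folklore] -/
theorem transferHalfSym_of_transferHalf {r : LatticeRep G} {sch : SpeciesScheme (YMSpecies G)} {Δ : ℝ}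
    (h : TransferHalf r sch Δ) : TransferHalfSym r sch Δ :=
  fun sch' ha hb hL _ _ T hT => h sch' ha hb hL T hT

/-- **The bridge, named**: for the `M`-adic scheme of the crux with `β_k → +∞` and physical volume
growth, uniform slab clustering at rate `Δ` gives the symmetric transfer clause at the SAME rate — the
landed `stub_transferSym` fed with the landed site reflection positivity `stub_negReflectRP`.
[cite: GlimmJaffe1987, §6.1 and §19.7] [cite: OsterwalderSeiler1978, §2] -/
theorem transferHalfSym_of_uniformSlabClustering (r : LatticeRep G) {M : ℕ}
    (sch : SpeciesScheme (YMSpecies G)) {n : ℕ → ℕ} {Δ : ℝ} (hM : 2 ≤ M)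
    (hshape : ∀ k, sch.a k = ((M : ℝ) ^ n k)⁻¹) (hβ : Tendsto sch.β atTop atTop)
    (hvol : sch.HasVolumeGrowth) (hclust : UniformSlabClustering r sch Δ) : TransferHalfSym r sch Δ :=
  fun sch' ha hb hL hsym hpoly T hT =>
    stub_transferSym G r M sch n Δ hM hshape hβ hvol
      (fun {b} hb' {Sh} hS F hF hFb {w} hw hdep =>
        stub_negReflectRP (β := b) (S := Sh) (w := w) r.ρ r.continuous hb' hS F hF hFb hw hdep)
      hclust sch' ha hb hL hsym hpoly T hT

end Transfer

end Summit.QuantumFields.YangMills.Cruxes.LatticeGapOnTrajectory.OrbitKantorovichFiniteSize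

end
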